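import Literature.NumberTheory.Sieve.LargestPrimeFactorCubicGenerators
import Literature.NumberTheory.LFunctions.CubeRootTwoFieldPID
import HarnessLib

/-!
# Heath-Brown 2001, §4: divisibility of `N(α)` through the roots of `x³ ≡ 2`

Eleventh proved layer of this seat under the named fact `HeathBrown2001_largestPrimeFactor_cubic`
(`LargestPrimeFactorCubic.lean`; D. R. Heath-Brown, *The largest prime factor of `X³ + 2`*, Proc.
London Math. Soc. (3) 82 (2001) 554–596).  In §4 (pp. 569–570) the sums `S₀`, `S₁` over
`L ∈ 𝓛(K)` with the sieve condition `d ∣ N(L)` are rewritten as sums over IDEALS `A` with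
`N(A) = d`, `ρ(A) = 1`: "we may take `d` to run over all square-free values of `N(A)`, where
`A ∣ R, L` … `KA ∣ a + b∛2 + c∛4` is therefore equivalent to a congruence of the form
`c ≡ c₁(a, b, KA) (mod KA)` … and this itself is equivalent to `c ≡ c₁(a, b, KA) (mod N(KA))`".
The ideals of norm `e` with `ρ = 1` are the `(e, ∛2 − j)` with `j³ ≡ 2 (mod e)`, so in rational
terms: for a generator `α = a + b∛2 + c∛4` with `ρ((α)) = 1`,

  `e ∣ N(α)  ⟺  ∃ j (mod e): j³ ≡ 2 (mod e) ∧ e ∣ a + bj + cj²`,  and such a `j` is unique.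

This file PROVES this (for the tree's `K = ℚ(∛2)`):

* `absNorm_span_pair_eq` — `N((e, ∛2 − j)) = e` whenever `j³ ≡ 2 (mod e)` (the ring map
  `ℤ[∛2] → ℤ/e`, `∛2 ↦ j`, from the integral power basis; and Lemma 1);
* `dvd_absNorm_iff_exists_root` — the displayed equivalence, and `root_unique` — uniqueness;
* `card_roots_filter_eq` — hence, as a counting identity,
  `#{j < e : e ∣ j³ − 2, e ∣ a + bj + cj²} = [e ∣ N(α)]`, and `sum_filter_dvd_absNorm_eq` — for a
  finite family of such generators `α_c` (fixed `a, b`),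
  `∑_{c : e ∣ N(α_c)} g(c) = ∑_{j < e, j³ ≡ 2} ∑_{c : e ∣ a + bj + cj²} g(c)` (the reorganisation
  of `S₀` and `S₁` by the classes of `c` modulo `N(KA)`, (4.2)–(4.4)).

## References

* D. R. Heath-Brown, *The largest prime factor of `X³ + 2`*, Proc. London Math. Soc. (3) 82 (2001)
  554–596, §4 pp. 569–571 ((4.2)–(4.4)). [`HeathBrown2001LargestPrimeFactorCubic`]
-/

noncomputable section

open NumberField Finset Polynomial

namespace Literature.NumberTheory.Sieve.LargestPrimeFactorCubic

open LFunctions.CubeRootTwoField CubicSieve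

/-! ### The ideals `(e, ∛2 − j)` -/

/-- `j` is a root of the minimal polynomial `X³ − 2` of `θ` in `ℤ/e` when `j³ ≡ 2 (mod e)`. [folklore] -/
theorem aeval_minpoly_eq_zero (e : ℕ) (j : ℤ) (hj : (e : ℤ) ∣ j ^ 3 - 2) :
    aeval (j : ZMod e) (minpoly ℤ integralPB.gen) = 0 := by
  rw [integralPB_gen, minpoly_θint]
  obtain ⟨m, hm⟩ := hj
  have h2 : ((j : ZMod e)) ^ 3 - 2 = 0 := by
    have : ((j ^ 3 - 2 : ℤ) : ZMod e) = 0 := by rw [hm]; push_cast; simp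
    push_cast at this; exact this
  simp only [cubicPoly, map_sub, map_pow, aeval_X, map_ofNat]
  exact h2

/-- The ring map `ℤ[∛2] → ℤ/e` sending `∛2 ↦ j`, for `j³ ≡ 2 (mod e)`. [folklore] -/
def rootHom (e : ℕ) (j : ℤ) (hj : (e : ℤ) ∣ j ^ 3 - 2) : 𝓞 K →ₐ[ℤ] ZMod e :=
  integralPB.lift (j : ZMod e) (aeval_minpoly_eq_zero e j hj)

/-- Auxiliary fact `rootHom_θint` for this file's estimates. [folklore] -/
theorem rootHom_θint (e : ℕ) (j : ℤ) (hj : (e : ℤ) ∣ j ^ 3 - 2) : rootHom e j hj θint = j := by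
  have h := PowerBasis.lift_gen integralPB (j : ZMod e) (aeval_minpoly_eq_zero e j hj)
  rw [integralPB_gen] at h
  exact h

/-- **`N((e, ∛2 − j)) = e`** for `e ≥ 1` and `j³ ≡ 2 (mod e)`: the ideal `(e, ∛2 − j)` is killed by
`∛2 ↦ j` (so `𝓞_K/(e, ∛2−j) ↠ ℤ/e`, `N ≥ e`) and has `ρ = 1` and contains `e` (so `N ∣ e`).
[cite: HeathBrown2001LargestPrimeFactorCubic, §4 p. 570] -/
theorem absNorm_span_pair_eq {e : ℕ} (he : 0 < e) {j : ℤ} (hj : (e : ℤ) ∣ j ^ 3 - 2) :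
    Ideal.absNorm (Ideal.span {(e : 𝓞 K), θint - j}) = e := by
  set I : Ideal (𝓞 K) := Ideal.span {(e : 𝓞 K), θint - j} with hI
  have heI : (e : 𝓞 K) ∈ I := Ideal.subset_span (Set.mem_insert _ _)
  have hjI : θint - (j : 𝓞 K) ∈ I := Ideal.subset_span (Set.mem_insert_of_mem _ rfl)
  -- `N(I) ∣ e`
  have h1 : Ideal.absNorm I ∣ e := by
    have := (intCast_mem_iff_absNorm_dvd hjI (e : ℤ)).1 (by exact_mod_cast heI)
    exact_mod_cast this
  -- `e ≤ N(I)` via the surjection onto `ℤ/e`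
  set φ := rootHom e j hj with hφ
  have hker : ∀ x ∈ I, φ x = 0 := by
    intro x hx
    refine Submodule.span_induction (p := fun x _ => φ x = 0) ?_ ?_ ?_ ?_ hx
    · rintro y (rfl | hy)
      · simp [map_natCast]
      · rw [Set.mem_singleton_iff] at hy
        rw [hy, map_sub, rootHom_θint]
        simp
    · simp
    · intro x y _ _ hx hy; rw [map_add, hx, hy, add_zero]
    · intro a x _ hx; rw [smul_eq_mul, map_mul, hx, mul_zero]
  set ψ : 𝓞 K ⧸ I →+* ZMod e := Ideal.Quotient.lift I φ.toRingHom hker with hψ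
  have hsurj : Function.Surjective ψ := ZMod.ringHom_surjective ψ
  have hI0 : I ≠ ⊥ := by
    intro h0
    rw [h0, Ideal.mem_bot] at heI
    exact he.ne' (by exact_mod_cast heI)
  haveI : Finite (𝓞 K ⧸ I) := Ideal.finiteQuotientOfFreeOfNeBot I hI0
  haveI : NeZero e := ⟨he.ne'⟩
  have h2 : e ≤ Ideal.absNorm I := by
    rw [Ideal.absNorm_apply, Submodule.cardQuot_apply]
    have := Nat.card_le_card_of_surjective ψ hsurj
    rwa [Nat.card_zmod] at this
  exact le_antisymm (Nat.le_of_dvd he h1) h2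

/-! ### `e ∣ N(α)` through the roots -/

section Roots

variable {a b c m : ℤ}

/-- If `∛2 ≡ m (mod (α))` then `N(α) ∣ m³ − 2` and `N(α) ∣ a + bm + cm²` (`α = a + b∛2 + c∛4`).
[cite: HeathBrown2001LargestPrimeFactorCubic, §4 p. 570] -/
theorem absNorm_dvd_of_root (hm : θint - (m : 𝓞 K) ∈ Ideal.span {coordElt (a, b, c)}) :
    ((Ideal.absNorm (Ideal.span {coordElt (a, b, c)}) : ℕ) : ℤ) ∣ m ^ 3 - 2 ∧
    ((Ideal.absNorm (Ideal.span {coordElt (a, b, c)}) : ℕ) : ℤ) ∣ a + b * m + c * m ^ 2 := by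
  constructor
  · rw [← intCast_mem_iff_absNorm_dvd hm]
    -- `m³ − 2 = m³ − θ³ = (m − θ)(m² + mθ + θ²)`
    have e : ((m ^ 3 - 2 : ℤ) : 𝓞 K) = -((θint - m) * (θint ^ 2 + θint * m + (m : 𝓞 K) ^ 2)) := by
      have h3 := θint_cube
      push_cast
      linear_combination h3
    rw [e]
    exact (Ideal.neg_mem_iff _).2 (Ideal.mul_mem_right _ _ hm)
  · exact (coordElt_mem_iff_dvd hm a b c).1 (Ideal.subset_span rfl)

/-- **`e ∣ N(α)` from a root**: if `j³ ≡ 2 (mod e)` and `e ∣ a + bj + cj²` then `e ∣ N(α)`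
(`α ∈ (e, ∛2 − j)`, an ideal of norm `e`). [cite: HeathBrown2001LargestPrimeFactorCubic, §4 p. 570] -/
theorem dvd_absNorm_of_root {e : ℕ} (he : 0 < e) {j : ℤ} (hj : (e : ℤ) ∣ j ^ 3 - 2)
    (h : (e : ℤ) ∣ a + b * j + c * j ^ 2) :
    e ∣ Ideal.absNorm (Ideal.span {coordElt (a, b, c)}) := by
  set I : Ideal (𝓞 K) := Ideal.span {(e : 𝓞 K), θint - j} with hI
  have hjI : θint - (j : 𝓞 K) ∈ I := Ideal.subset_span (Set.mem_insert_of_mem _ rfl)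
  have hN := absNorm_span_pair_eq he hj
  have hα : coordElt (a, b, c) ∈ I := by
    rw [coordElt_mem_iff_dvd hjI, hN]
    exact h
  rw [← hN]
  exact Ideal.absNorm_dvd_absNorm_of_le ((Ideal.span_singleton_le_iff_mem _).2 hα)

/-- **A root from `e ∣ N(α)`**: if `ρ((α)) = 1` (root `m`) and `e ∣ N(α)` then `j = m` works:
`e ∣ m³ − 2` and `e ∣ a + bm + cm²`. [cite: HeathBrown2001LargestPrimeFactorCubic, §4 p. 570] -/
theorem exists_root_of_dvd_absNorm (hm : θint - (m : 𝓞 K) ∈ Ideal.span {coordElt (a, b, c)})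
    {e : ℕ} (h : e ∣ Ideal.absNorm (Ideal.span {coordElt (a, b, c)})) :
    (e : ℤ) ∣ m ^ 3 - 2 ∧ (e : ℤ) ∣ a + b * m + c * m ^ 2 := by
  obtain ⟨h1, h2⟩ := absNorm_dvd_of_root hm
  have he : (e : ℤ) ∣ ((Ideal.absNorm (Ideal.span {coordElt (a, b, c)}) : ℕ) : ℤ) := by exact_mod_cast h
  exact ⟨he.trans h1, he.trans h2⟩

/-- **Uniqueness of the root class**: if `ρ((α)) = 1` and `j, j'` are cube roots of `2` modulo
`e ≥ 1` with `e ∣ a + bj + cj²`, `e ∣ a + bj' + cj'²`, then `j ≡ j' (mod e)` (the ideals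
`(e, ∛2 − j)`, `(e, ∛2 − j')` both contain `(α) ∋ ∛2 − m` and have norm `e`, so they coincide by
Lemma 1). [cite: HeathBrown2001LargestPrimeFactorCubic, Lemma 1 and §4 p. 570] -/
theorem root_unique (hm : θint - (m : 𝓞 K) ∈ Ideal.span {coordElt (a, b, c)}) {e : ℕ} (he : 0 < e)
    {j j' : ℤ} (hj : (e : ℤ) ∣ j ^ 3 - 2) (hj' : (e : ℤ) ∣ j' ^ 3 - 2)
    (h : (e : ℤ) ∣ a + b * j + c * j ^ 2) (h' : (e : ℤ) ∣ a + b * j' + c * j' ^ 2) :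
    (e : ℤ) ∣ j - j' := by
  set J : Ideal (𝓞 K) := Ideal.span {coordElt (a, b, c)} with hJ
  set I : Ideal (𝓞 K) := Ideal.span {(e : 𝓞 K), θint - j} with hI
  set I' : Ideal (𝓞 K) := Ideal.span {(e : 𝓞 K), θint - j'} with hI'
  have hjI : θint - (j : 𝓞 K) ∈ I := Ideal.subset_span (Set.mem_insert_of_mem _ rfl)
  have hjI' : θint - (j' : 𝓞 K) ∈ I' := Ideal.subset_span (Set.mem_insert_of_mem _ rfl)
  have hN : Ideal.absNorm I = e := absNorm_span_pair_eq he hj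
  have hN' : Ideal.absNorm I' = e := absNorm_span_pair_eq he hj'
  have hα : coordElt (a, b, c) ∈ I := by rw [coordElt_mem_iff_dvd hjI, hN]; exact h
  have hα' : coordElt (a, b, c) ∈ I' := by rw [coordElt_mem_iff_dvd hjI', hN']; exact h'
  have hJI : J ≤ I := (Ideal.span_singleton_le_iff_mem _).2 hα
  have hJI' : J ≤ I' := (Ideal.span_singleton_le_iff_mem _).2 hα'
  have hI0 : I ≠ ⊥ := by
    intro h0
    rw [h0, Ideal.absNorm_bot] at hN
    omega
  have hII' : I = I' := eq_of_θint_sub_mem_of_absNorm_eq hI0 (hJI hm) (hJI' hm) (hN.trans hN'.symm)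
  -- `θ − j, θ − j' ∈ I` so `j' − j ∈ I ∩ ℤ = eℤ`
  have hdiff : ((j - j' : ℤ) : 𝓞 K) ∈ I := by
    have := I.sub_mem (hII' ▸ hjI') hjI
    have e1 : θint - (j' : 𝓞 K) - (θint - j) = ((j - j' : ℤ) : 𝓞 K) := by push_cast; ring
    rwa [e1] at this
  have := (intCast_mem_iff_absNorm_dvd hjI (j - j')).1 hdiff
  rwa [hN] at this

/-- **The counting identity**: for `ρ((α)) = 1` and `e ≥ 1`,
`#{j < e : e ∣ j³ − 2 ∧ e ∣ a + bj + cj²} = [e ∣ N(α)]`.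
[cite: HeathBrown2001LargestPrimeFactorCubic, §4 (4.2)–(4.3)] -/
theorem card_roots_filter_eq (hm : θint - (m : 𝓞 K) ∈ Ideal.span {coordElt (a, b, c)})
    {e : ℕ} (he : 0 < e) :
    #((range e).filter fun j : ℕ => (e : ℤ) ∣ (j : ℤ) ^ 3 - 2 ∧ (e : ℤ) ∣ a + b * j + c * (j : ℤ) ^ 2) =
      if e ∣ Ideal.absNorm (Ideal.span {coordElt (a, b, c)}) then 1 else 0 := by
  split_ifs with hdvd
  · -- exactly one root class: `m mod e`
    obtain ⟨h1, h2⟩ := exists_root_of_dvd_absNorm hm hdvd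
    rw [card_eq_one]
    refine ⟨(m % e).toNat, ?_⟩
    have hm0 : (0 : ℤ) ≤ m % e := Int.emod_nonneg _ (by exact_mod_cast he.ne')
    have hme : ((m % e).toNat : ℤ) = m % e := Int.toNat_of_nonneg hm0
    have hcong : (e : ℤ) ∣ m - m % e := ⟨m / e, by linarith [Int.mul_ediv_add_emod m e]⟩
    ext j
    simp only [mem_filter, mem_range, mem_singleton]
    constructor
    · rintro ⟨hje, hj3, hjv⟩
      have hu := root_unique hm he hj3 h1 hjv h2
      -- `j ≡ m (mod e)` and `0 ≤ j < e` force `j = m mod e`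
      have : (j : ℤ) = m % e := by
        have hj0 : (0 : ℤ) ≤ j := by positivity
        have hje' : (j : ℤ) < e := by exact_mod_cast hje
        obtain ⟨t, ht⟩ := hu
        have : (j : ℤ) % e = m % e := by
          rw [show (j : ℤ) = m + e * t by linarith, Int.add_mul_emod_self_left]
        rw [← this, Int.emod_eq_of_lt hj0 hje']
      omega
    · intro hj
      subst hj
      refine ⟨?_, ?_, ?_⟩
      · have : ((m % e : ℤ)) < e := Int.emod_lt_of_pos _ (by exact_mod_cast he)
        omega
      · rw [hme]
        -- `(m mod e)³ − 2 ≡ m³ − 2 (mod e)`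
        have h := (Int.mod_modEq m e).pow 3
        have hd : (e : ℤ) ∣ m ^ 3 - (m % e) ^ 3 := h.dvd
        have h' := dvd_sub h1 hd
        have eq : m ^ 3 - 2 - (m ^ 3 - (m % e) ^ 3) = (m % ↑e) ^ 3 - 2 := by ring
        rwa [eq] at h'
      · rw [hme]
        obtain ⟨t, ht⟩ := hcong
        have em : m % e = m - e * t := by linarith
        rw [em]
        have : (e : ℤ) ∣ a + b * (m - e * t) + c * (m - e * t) ^ 2 - (a + b * m + c * m ^ 2) :=
          ⟨-(b * t) - c * (2 * m * t) + c * e * t ^ 2, by ring⟩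
        have h' := dvd_add this h2
        rwa [sub_add_cancel] at h'
  · -- no root class
    rw [card_eq_zero, filter_eq_empty_iff]
    rintro j - ⟨hj3, hjv⟩
    exact hdvd (dvd_absNorm_of_root he hj3 hjv)

end Roots

/-! ### Reorganising a sum over `c` by root classes -/

/-- **`∑_{c : e ∣ N(α_c)} g(c) = ∑_{j} ∑_{c : e ∣ a + bj + γ_c j²} g(c)`** over the cube roots
`j < e` of `2` modulo `e`, for a finite family of generators `α_c = a + b∛2 + γ_c∛4` (fixed `a, b`,
third coordinate `γ_c ∈ ℤ`) each with `ρ((α_c)) = 1` — the reorganisation of §4 ((4.2)–(4.4)) in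
rational form. [cite: HeathBrown2001LargestPrimeFactorCubic, §4 (4.4)] -/
theorem sum_filter_dvd_absNorm_eq {ι : Type*} {a b : ℤ} (F : Finset ι) (γ : ι → ℤ)
    (hρ : ∀ c ∈ F, ∃ m : ℤ, θint - (m : 𝓞 K) ∈ Ideal.span {coordElt (a, b, γ c)})
    {e : ℕ} (he : 0 < e) (g : ι → ℝ) :
    ∑ c ∈ F.filter (fun c => e ∣ Ideal.absNorm (Ideal.span {coordElt (a, b, γ c)})), g c =
      ∑ j ∈ (range e).filter (fun j : ℕ => (e : ℤ) ∣ (j : ℤ) ^ 3 - 2),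
        ∑ c ∈ F.filter (fun c => (e : ℤ) ∣ a + b * j + γ c * (j : ℤ) ^ 2), g c := by
  classical
  -- both sides equal `∑_{c ∈ F} g(c) · #{j : root, e ∣ a+bj+γ_c j²}`
  rw [sum_filter]
  have hrhs : ∑ j ∈ (range e).filter (fun j : ℕ => (e : ℤ) ∣ (j : ℤ) ^ 3 - 2),
      ∑ c ∈ F.filter (fun c => (e : ℤ) ∣ a + b * j + γ c * (j : ℤ) ^ 2), g c =
      ∑ c ∈ F, ∑ j ∈ (range e).filter (fun j : ℕ => (e : ℤ) ∣ (j : ℤ) ^ 3 - 2),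
        if (e : ℤ) ∣ a + b * j + γ c * (j : ℤ) ^ 2 then g c else 0 := by
    rw [sum_comm]
    refine sum_congr rfl (fun j _ => ?_)
    rw [sum_filter]
  rw [hrhs]
  refine sum_congr rfl (fun c hc => ?_)
  obtain ⟨m, hm⟩ := hρ c hc
  have hcard := card_roots_filter_eq hm he
  -- `∑_j [root ∧ e ∣ …] g c = g c · #{…}`
  have : ∑ j ∈ (range e).filter (fun j : ℕ => (e : ℤ) ∣ (j : ℤ) ^ 3 - 2),
      (if (e : ℤ) ∣ a + b * j + γ c * (j : ℤ) ^ 2 then g c else 0) =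
      g c * #((range e).filter fun j : ℕ =>
        (e : ℤ) ∣ (j : ℤ) ^ 3 - 2 ∧ (e : ℤ) ∣ a + b * j + γ c * (j : ℤ) ^ 2) := by
    rw [← sum_filter, sum_const, nsmul_eq_mul, mul_comm, filter_filter]
  rw [this, hcard]
  split_ifs <;> simp

end Literature.NumberTheory.Sieve.LargestPrimeFactorCubic
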